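import Summits.HubbardSuperconductivity.HubbardSuperconductivity.Theses.ColourTheSpin
import HarnessLib

/-!
# Crux `SgCorridor` (stmt-HubbardSuperconductivity-16274; route `ColourTheSpin`, rank 4, "corridor
transfer") — STRATEGIST LINE `Lines/anchor_vacuity.lean` (alternative to `Lines/birth.lean`)

Seat `planner-cstrat-stmt-HubbardSuperconductivity-16274-b1-0` (crux-strategist before the lead), 2026-08-17.

THE CRUX (fixed, not restated): `SgCorridor := SgAnchorOrder → SgCorridorOrder` — an implication between two
INDEPENDENT existential items of the route (the `(U, δ)` of the conclusion is not tied to the anchor's).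
Hence, propositionally, `SgCorridor ↔ (¬ SgAnchorOrder ∨ SgCorridorOrder)`, and there are exactly two
ways to prove it: prove the route target `SgCorridorOrder` outright (summit-hard: every-ground-state
`B1g` pair order of the Q8-spin-gauged Hubbard torus on a whole corridor `g ∈ (0, g₀]`), or REFUTE THE
HYPOTHESIS `SgAnchorOrder`.

THE LINE (lens: NEGATION of the hypothesis — "strong-coupling link freezing"). `SgAnchorOrder` asks for ONE
constant `c > 0` serving ALL gauge couplings `g ≥ g₀` (unbounded above). At fixed side `L`, as `g → ∞`
the electric weight `g² Σ_b E_b` (inlined: `E_b = 1 − Q_b`, `Q_b` = averaging over the value of link `b`)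
forces every ground state of the `N_L`-block into the ELECTRIC VACUUM `Π₀ = (fermions) ⊗ |constant link
function⟩` up to `‖(1 − Π₀)ψ‖² = O_{L,U}(g⁻²)‖ψ‖²`, while the gauge-covariant bond pair field
`P = Σ_b ± Σ_{στ} c_{xσ}c_{x+e_i,τ} ⊗ diag_k (ερ(k_b))_{στ}` MULTIPLIES link `b` by a function of ZERO
`Q8`-average (`Σ_{u ∈ Q8} ρ(u) = 0` — the route's own Elitzur input), so `P_b Π₀ψ ⟂ P_{b'} Π₀ψ` for
`b ≠ b'` (flux orthogonality) and `‖P Π₀ ψ‖² = Σ_b ‖P_b Π₀ψ‖² ≤ 32 L² ‖ψ‖²`: NO off-diagonal long-range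
order of the transported pair field survives at the frozen end, `⟨ψ, P†P ψ⟩ ≤ 33 L² ‖ψ‖²` for
`g ≥ G(L,U)`, contradicting `c L⁴ ≤ ⟨ψ, P†P ψ⟩` as soon as `c L² > 33`. (Found independently by
refuter-rreview-0816T18-1-0 — evidence `EVIDENCE-ColourTheSpin-SgAnchorOrder.md` v1–v3 on item
stmt-…-16273, kernel-checked Schur facts `CTS_SchurFacts.lean`, toy ED kit job j019493: all bond-pair
observables `∝ g⁻⁴`, d-wave combination `≡ 0` — and by the 16273 registrar, whose checked NEGATION SKELETON
`Cruxes/SgAnchorOrder/NegationSkeleton.lean` this file deliberately SHARES ITS TWO STUBS WITH, statement for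
statement: one proof of each stub closes 16274 (this crux, proved — vacuously), refutes 16273, and discharges
both stubs of `Lines/birth.lean`, see §5; §6 kernel-checks the algebraic inputs of the stubs: `Σ_u ρ(u) = 0`,
flux creation by `P`, Schur orthogonality, self-conjugate traces.)

STUBS (the only `sorry`s; both believed TRUE, finite-dimensional linear algebra over the crux's inlined lets):
1. `stub_pairCeiling` — `O(L²)` PAIR CEILING AT THE FROZEN END: `∃ A, ∀ U > 0, ∀ δ ∈ (0,½), ∀ L ≥ 1, ∃ G,
   ∀ g ≥ G`, every ground state `ψ` of the `N_L`-block of `H_g(L,U)` has `⟨ψ,(P†P)_B ψ⟩.re ≤ A·L²·(ψ†ψ).re`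
   (`CeilingAt A U δ g L`; witnesses `A = 33`, `G = max(1, 91 L⁴ √(U+18))`). Size M–L (kronecker/block
   bookkeeping; inputs: `Σ_u (ερ(u))_{στ} = 0`, Schur orthogonality `(1/8)Σ_u conj((ερ(u))_{στ})(ερ(u))_{σ'τ'}
   = ½ δ_{σσ'}δ_{ττ'}`, `‖hop + hop†‖ ≤ 16L²`, `‖P‖ ≤ 8L²`, trial energy `≤ U·N_L + 2L²/g²`, electric/magnetic/U
   terms PSD). = `Negation.PairCeiling` of the 16273 skeleton with its matrix named `CeilingAt`.
2. `stub_groundStateExists` — THE BLOCK HAS A NORMALISED GROUND STATE in the crux's own sense for all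
   `U, δ ∈ (0,½), g`, `L ≥ 1` (`HasNormalisedGroundState U δ g L`): `H` Hermitian (hop + hopᴴ; real krons of
   Hermitian diagonal / real-symmetric electric / real-diagonal magnetic terms, `tr ρ(u) ∈ {2,0,−2}`), block
   index type non-empty (`N_L = 2⌊(1−δ)L²/2⌋ ≤ 2L²`), bottom eigenvector of `Matrix.IsHermitian.eigenvalues`
   minimises the Rayleigh quotient. Size S–M. = `Negation.GroundStateExists` with its matrix named.

COMPOSITION (sorry-free, kernel-checked): `orderOnHalfLine_false` (pointwise core: at any `(U,δ,g₀,c,L₀)` the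
anchor matrix on the half-line `[g₀,∞)` is uninhabited — Archimedean even `L`, `g := max g₀ G`, one
`le_trans` through the shared let-block) ⟹ `not_SgAnchorOrder_of_stubs` ⟹ `SgCorridor_of :
Sig.stub_pairCeiling → Sig.stub_groundStateExists → SgCorridor` (ex falso) and `SgCorridor_proof :
SgCorridor` BY NAME. §5 proves, from the same two stubs, the statements of BOTH stubs of `Lines/birth.lean`
(`stub_halfLinePersistence`, `stub_zeroCouplingFloor`, over a verbatim copy of birth's vocabulary `OrderAt`,
`HalfLineOrder`, `CorridorOrderAt`): their hypotheses assert `g`-uniform order on half-lines and are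
uninhabited for every `(U, δ)`, so the birth line's "deconfinement-crossing" physics is never reached — a
lead seated on `birth` should switch to this line at once.

WHAT THIS LINE IS NOT: it is not progress toward the summit. It settles the crux AS TYPED (true, vacuously)
and exposes that the route's anchor is dead (route KILL CRITERION: "refutation of SgAnchorOrder … closes the
route, close --reason refuted:SgAnchorOrder"; class `substantive`: at the confined end the charge sector is a
frozen lattice gas of immobile single electrons — all Gauss sectors admitted — and even the `g`-rescaled bond
pair order is pure `A1g`, the `B1g` combination vanishing identically by `Σ_e g_d(e) = 0` once the pair
field is projected onto on-site doublons; see `Lines/anchor_vacuity.md` and `STRATEGY-CENSUS.md`).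

DISPROOF USED: no `Cruxes/SgCorridor/Disproof.lean` exists (2026-08-17; payload disproof_path absent); no
`Theorems/SgCorridor/Negative/`. Honoured instead: the attached refutation evidence of the HYPOTHESIS item
16273 (above) — this line is its corollary; negatives index (stmt-1180 `BreathingSelfDual`, stmt-1314
`KlsOrderOpenness`): no stub is an instance (both are statements about the one inlined family `H_g`).

Sources: J. Kogut, L. Susskind, PRD 11 (1975) 395 (doi:10.1103/physrevd.11.395) — group-element link basis,
electric term, strong-coupling vacuum; S. Elitzur, PRD 12 (1975) 3978 (doi:10.1103/physrevd.12.3978) —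
`Σ_u ρ(u) = 0`; K. Osterwalder, E. Seiler, Ann. Phys. 110 (1978) 440 (doi:10.1016/0003-4916(78)90039-8) —
strong-coupling expansion (what `O(g⁻⁴)` pair correlations look like); T. Kato, Perturbation Theory for
Linear Operators (1966) I-§6.10, II-§5 (min–max, finite-dimensional perturbation); Mathlib
`Matrix.IsHermitian.eigenvectorBasis`.
-/

noncomputable section

-- `dupNamespace`: the summit and the problem are both named `HubbardSuperconductivity` (layout D-0022)
set_option linter.dupNamespace false
set_option linter.unusedVariables false

namespace Summit.HubbardSuperconductivity.HubbardSuperconductivity.Cruxes.SgCorridor.AnchorVacuity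

open scoped Matrix ComplexOrder BigOperators
open Literature.Probability.LatticeModels Literature.MathematicalPhysics.QuantumLattice
open Literature.Hubbard
open Summit.HubbardSuperconductivity.HubbardSuperconductivity.Theses.ColourTheSpin
  (SgCorridor SgAnchorOrder SgCorridorOrder)

/-! ### §1 Vocabulary (plain `def`s over existing declarations; every matrix is VERBATIM the route file's
inlined let-block, so that the route items are `Iff.rfl`-equal to prefixed statements over it) -/

/-- `OrderAt U δ g c L₀` — eventual every-ground-state gauged `B1g` pair order at `(U, δ, g)` with constant
`c` from side `L₀` on (verbatim `Lines/birth.lean`'s `OrderAt`, itself verbatim the common matrix of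
`SgAnchorOrder` / `SgCorridorOrder` / the hypothesis of `SgEndpoint`). [Kogut–Susskind 1975; Scalapino 1995 §2] -/
def OrderAt (U δ g c : ℝ) (L₀ : ℕ) : Prop :=
  ∀ (L : ℕ) [NeZero L], L₀ ≤ L → Even L →
      (let m : Fin 2 × ZMod 4 → Fin 2 × ZMod 4 → Fin 2 × ZMod 4 := fun u v => (u.1 + v.1, if u.1 = 0 then (if v.1 = 0 then u.2 + v.2 else v.2 - u.2) else if v.1 = 0 then u.2 + v.2 else 2 + v.2 - u.2);
        let iv : Fin 2 × ZMod 4 → Fin 2 × ZMod 4 := fun u => (u.1, if u.1 = 0 then -u.2 else u.2 + 2);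
        let r : Fin 2 × ZMod 4 → Fin 2 → Fin 2 → ℂ := fun u σ τ => if u.1 = 0 then (if σ = τ then (if σ = 0 then Complex.I else -Complex.I) ^ u.2.val else 0)
          else if σ = τ then 0 else if σ = 0 then -(-Complex.I) ^ u.2.val else Complex.I ^ u.2.val;
        let hop := ∑ b : GaugedHubbard.Bond L, ∑ σ : Fin 2, ∑ τ : Fin 2, Matrix.kroneckerMap (· * ·) (creation (orb b.1 σ) * annihilation (orb (b.1.shift b.2) τ))
            (Matrix.diagonal fun k : GaugedHubbard.Bond L → Fin 2 × ZMod 4 => r (k b) σ τ);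
        let H := -(hop + hopᴴ)
            + ((U : ℝ) : ℂ) • Matrix.kroneckerMap (· * ·) (∑ x : FermionTorus 2 L, numberOp x 0 * numberOp x 1) (1 : Matrix (GaugedHubbard.Bond L → Fin 2 × ZMod 4) (GaugedHubbard.Bond L → Fin 2 × ZMod 4) ℂ)
            + ((g ^ 2 : ℝ) : ℂ) • Matrix.kroneckerMap (· * ·) (1 : Matrix (Finset (Orb (FermionTorus 2 L))) _ ℂ)
              (∑ b : GaugedHubbard.Bond L, Matrix.of fun k k' : GaugedHubbard.Bond L → Fin 2 × ZMod 4 => if k' = Function.update k b (k' b) then (if k b = k' b then (1 : ℂ) else 0) - 1 / 8 else 0)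
            + ((1 / g ^ 2 : ℝ) : ℂ) • Matrix.kroneckerMap (· * ·) (1 : Matrix (Finset (Orb (FermionTorus 2 L))) _ ℂ)
              (Matrix.diagonal fun k : GaugedHubbard.Bond L → Fin 2 × ZMod 4 => ∑ x : FermionTorus 2 L, (1 - (r (m (m (m (k (x, 0)) (k (x.shift 0, 1))) (iv (k (x.shift 1, 0)))) (iv (k (x, 1)))) 0 0
                + r (m (m (m (k (x, 0)) (k (x.shift 0, 1))) (iv (k (x.shift 1, 0)))) (iv (k (x, 1)))) 1 1) / 2));
        let P := ∑ b : GaugedHubbard.Bond L, (if b.2 = 0 then (1 : ℂ) else -1) • ∑ σ : Fin 2, ∑ τ : Fin 2, Matrix.kroneckerMap (· * ·) (annihilation (orb b.1 σ) * annihilation (orb (b.1.shift b.2) τ))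
            (Matrix.diagonal fun k : GaugedHubbard.Bond L → Fin 2 × ZMod 4 => if σ = 0 then r (k b) 1 τ else -r (k b) 0 τ);
        let p := fun ik : Finset (Orb (FermionTorus 2 L)) × (GaugedHubbard.Bond L → Fin 2 × ZMod 4) => ik.1.card = 2 * ⌊(1 - δ) * (L : ℝ) ^ 2 / 2⌋₊;
        ∀ ψ : {ik // p ik} → ℂ, 
          (ψ ≠ 0 ∧ ∃ E : ℝ, H.toBlock p p *ᵥ ψ = (E : ℂ) • ψ ∧ ∀ φ : {ik // p ik} → ℂ, E * (star φ ⬝ᵥ φ).re ≤ (star φ ⬝ᵥ H.toBlock p p *ᵥ φ).re) →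
          c * (L : ℝ) ^ 4 * (star ψ ⬝ᵥ ψ).re ≤ (star ψ ⬝ᵥ (Pᴴ * P).toBlock p p *ᵥ ψ).re)

/-- `HalfLineOrder U δ` — order on every closed half-line `[g₁, ∞)` of couplings with floor-dependent
constants (verbatim `Lines/birth.lean`). The conclusion of birth's stub 1 and hypothesis of its stub 2;
UNINHABITED for every `U > 0`, `δ ∈ (0,½)` given the two stubs of this file (`halfLineOrder_false`). -/
def HalfLineOrder (U δ : ℝ) : Prop :=
  ∀ g₁ : ℝ, 0 < g₁ → ∃ c₁ : ℝ, 0 < c₁ ∧ ∃ L₁ : ℕ, ∀ g : ℝ, g₁ ≤ g → OrderAt U δ g c₁ L₁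

/-- `CorridorOrderAt U δ` — corridor order at `(U, δ)` (verbatim `Lines/birth.lean`; the matrix of the route
target `SgCorridorOrder` at `(U, δ)`). -/
def CorridorOrderAt (U δ : ℝ) : Prop :=
  ∃ g₀ : ℝ, 0 < g₀ ∧ ∃ c' : ℝ, 0 < c' ∧ ∃ L₁ : ℕ, ∀ g : ℝ, 0 < g → g ≤ g₀ → OrderAt U δ g c' L₁

/-- `CeilingAt A U δ g L` — at coupling `g` and side `L`, EVERY ground state `ψ` of the `N_L`-block of the
inlined Q8-spin-gauged torus `H_g(L,U)` has `⟨ψ, (P†P)_B ψ⟩.re ≤ A·L²·(ψ†ψ).re` (the matrix of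
`Cruxes/SgAnchorOrder/NegationSkeleton.lean`'s `PairCeiling`, verbatim; same lets as `OrderAt`). -/
def CeilingAt (A U δ g : ℝ) (L : ℕ) [NeZero L] : Prop :=
  (let m : Fin 2 × ZMod 4 → Fin 2 × ZMod 4 → Fin 2 × ZMod 4 := fun u v => (u.1 + v.1, if u.1 = 0 then (if v.1 = 0 then u.2 + v.2 else v.2 - u.2) else if v.1 = 0 then u.2 + v.2 else 2 + v.2 - u.2); let iv : Fin 2 × ZMod 4 → Fin 2 × ZMod 4 := fun u => (u.1, if u.1 = 0 then -u.2 else u.2 + 2); let r : Fin 2 × ZMod 4 → Fin 2 → Fin 2 → ℂ := fun u σ τ => if u.1 = 0 then (if σ = τ then (if σ = 0 then Complex.I else -Complex.I) ^ u.2.val else 0) else if σ = τ then 0 else if σ = 0 then -(-Complex.I) ^ u.2.val else Complex.I ^ u.2.val; let hop := ∑ b : GaugedHubbard.Bond L, ∑ σ : Fin 2, ∑ τ : Fin 2, Matrix.kroneckerMap (· * ·) (creation (orb b.1 σ) * annihilation (orb (b.1.shift b.2) τ)) (Matrix.diagonal fun k : GaugedHubbard.Bond L → Fin 2 × ZMod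 4 => r (k b) σ τ); let H := -(hop + hopᴴ) + ((U : ℝ) : ℂ) • Matrix.kroneckerMap (· * ·) (∑ x : FermionTorus 2 L, numberOp x 0 * numberOp x 1) (1 : Matrix (GaugedHubbard.Bond L → Fin 2 × ZMod 4) (GaugedHubbard.Bond L → Fin 2 × ZMod 4) ℂ) + ((g ^ 2 : ℝ) : ℂ) • Matrix.kroneckerMap (· * ·) (1 : Matrix (Finset (Orb (FermionTorus 2 L))) _ ℂ) (∑ b : GaugedHubbard.Bond L, Matrix.of fun k k' : GaugedHubbard.Bond L → Fin 2 × ZMod 4 => if k' = Function.update k b (k' b) then (if k b = k' b then (1 : ℂ) else 0) - 1 / 8 else 0) + ((1 / g ^ 2 : ℝ) : ℂ) • Matrix.kroneckerMap (· * ·) (1 : Matrix (Finset (Orb (FermionTorus 2 L))) _ ℂ) (Matrix.diagonal fun k : GaugedHubbard.Bond L → Fin 2 × ZMod 4 => ∑ x : FermionTorus 2 L, (1 - (r (m (m (m (k (x, 0)) (k (x.shift 0, 1))) (iv (k (x.shift 1, 0)))) (iv (k (x, 1)))) 0 0 + r (m (m (m (k (x, 0)) (k (x.shift 0, 1))) (iv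 (k (x.shift 1, 0)))) (iv (k (x, 1)))) 1 1) / 2)); let P := ∑ b : GaugedHubbard.Bond L, (if b.2 = 0 then (1 : ℂ) else -1) • ∑ σ : Fin 2, ∑ τ : Fin 2, Matrix.kroneckerMap (· * ·) (annihilation (orb b.1 σ) * annihilation (orb (b.1.shift b.2) τ)) (Matrix.diagonal fun k : GaugedHubbard.Bond L → Fin 2 × ZMod 4 => if σ = 0 then r (k b) 1 τ else -r (k b) 0 τ); let p := fun ik : Finset (Orb (FermionTorus 2 L)) × (GaugedHubbard.Bond L → Fin 2 × ZMod 4) => ik.1.card = 2 * ⌊(1 - δ) * (L : ℝ) ^ 2 / 2⌋₊; ∀ ψ : {ik // p ik} → ℂ, (ψ ≠ 0 ∧ ∃ E : ℝ, H.toBlock p p *ᵥ ψ = (E : ℂ) • ψ ∧ ∀ φ : {ik // p ik} → ℂ, E * (star φ ⬝ᵥ φ).re ≤ (star φ ⬝ᵥ H.toBlock p p *ᵥ φ).re) → (star ψ ⬝ᵥ (Pᴴ * P).toBlock p p *ᵥ ψ).re ≤ A * (L : ℝ) ^ 2 * (star ψ ⬝ᵥ ψ).re)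

/-- `HasNormalisedGroundState U δ g L` — the `N_L`-block of the inlined `H_g(L,U)` has a normalised ground
state in the crux's own sense (`ψ†ψ = 1`, `ψ ≠ 0`, eigenvector at an eigenvalue below every Rayleigh
quotient of the block); the matrix of `NegationSkeleton.lean`'s `GroundStateExists`, verbatim (lets without
`P`). -/
def HasNormalisedGroundState (U δ g : ℝ) (L : ℕ) [NeZero L] : Prop :=
  (let m : Fin 2 × ZMod 4 → Fin 2 × ZMod 4 → Fin 2 × ZMod 4 := fun u v => (u.1 + v.1, if u.1 = 0 then (if v.1 = 0 then u.2 + v.2 else v.2 - u.2) else if v.1 = 0 then u.2 + v.2 else 2 + v.2 - u.2); let iv : Fin 2 × ZMod 4 → Fin 2 × ZMod 4 := fun u => (u.1, if u.1 = 0 then -u.2 else u.2 + 2); let r : Fin 2 × ZMod 4 → Fin 2 → Fin 2 → ℂ := fun u σ τ => if u.1 = 0 then (if σ = τ then (if σ = 0 then Complex.I else -Complex.I) ^ u.2.val else 0) else if σ = τ then 0 else if σ = 0 then -(-Complex.I) ^ u.2.val else Complex.I ^ u.2.val; let hop := ∑ b : GaugedHubbard.Bond L, ∑ σ : Fin 2,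 ∑ τ : Fin 2, Matrix.kroneckerMap (· * ·) (creation (orb b.1 σ) * annihilation (orb (b.1.shift b.2) τ)) (Matrix.diagonal fun k : GaugedHubbard.Bond L → Fin 2 × ZMod 4 => r (k b) σ τ); let H := -(hop + hopᴴ) + ((U : ℝ) : ℂ) • Matrix.kroneckerMap (· * ·) (∑ x : FermionTorus 2 L, numberOp x 0 * numberOp x 1) (1 : Matrix (GaugedHubbard.Bond L → Fin 2 × ZMod 4) (GaugedHubbard.Bond L → Fin 2 × ZMod 4) ℂ) + ((g ^ 2 : ℝ) : ℂ) • Matrix.kroneckerMap (· * ·) (1 : Matrix (Finset (Orb (FermionTorus 2 L))) _ ℂ) (∑ b : GaugedHubbard.Bond L, Matrix.of fun k k' : GaugedHubbard.Bond L → Fin 2 × ZMod 4 => if k' = Function.update k b (k' b) then (if k b = k' b then (1 : ℂ) else 0) - 1 / 8 else 0) + ((1 / g ^ 2 : ℝ) : ℂ) • Matrix.kroneckerMap (· * ·) (1 : Matrix (Finset (Orb (FermionTorus 2 L))) _ ℂ) (Matrix.diagonal fun k : GaugedHubbard.Bond L → Fin 2 × ZMod 4 => ∑ x : FermionTorus 2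 L, (1 - (r (m (m (m (k (x, 0)) (k (x.shift 0, 1))) (iv (k (x.shift 1, 0)))) (iv (k (x, 1)))) 0 0 + r (m (m (m (k (x, 0)) (k (x.shift 0, 1))) (iv (k (x.shift 1, 0)))) (iv (k (x, 1)))) 1 1) / 2)); let p := fun ik : Finset (Orb (FermionTorus 2 L)) × (GaugedHubbard.Bond L → Fin 2 × ZMod 4) => ik.1.card = 2 * ⌊(1 - δ) * (L : ℝ) ^ 2 / 2⌋₊; ∃ ψ : {ik // p ik} → ℂ, star ψ ⬝ᵥ ψ = 1 ∧ (ψ ≠ 0 ∧ ∃ E : ℝ, H.toBlock p p *ᵥ ψ = (E : ℂ) • ψ ∧ ∀ φ : {ik // p ik} → ℂ, E * (star φ ⬝ᵥ φ).re ≤ (star φ ⬝ᵥ H.toBlock p p *ᵥ φ).re))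

/-! ### §2 Stub signatures (`Sig.stub_*`: named copies, so that the hypothesis heads of `SgCorridor_of`
carry the registered stub names) -/

/-- STUB 1 signature — the `O(L²)` pair ceiling at the frozen end (quantifier prefix of
`Negation.PairCeiling`, matrix `CeilingAt`). -/
def Sig.stub_pairCeiling : Prop :=
  ∃ A : ℝ, ∀ U : ℝ, 0 < U → ∀ δ ∈ Set.Ioo (0 : ℝ) (1 / 2), ∀ (L : ℕ) [NeZero L], ∃ G : ℝ,
    ∀ g : ℝ, G ≤ g → CeilingAt A U δ g L

/-- STUB 2 signature — existence of a normalised ground state of the block (quantifier prefix of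
`Negation.GroundStateExists`, matrix `HasNormalisedGroundState`). -/
def Sig.stub_groundStateExists : Prop :=
  ∀ (U δ g : ℝ) (L : ℕ) [NeZero L], δ ∈ Set.Ioo (0 : ℝ) (1 / 2) → HasNormalisedGroundState U δ g L

/-! ### §3 Registered stubs (the only `sorry`s of this file) -/

/-- **STUB 1 `stub_pairCeiling` — `O(L²)` CEILING OF THE TRANSPORTED PAIR FIELD AT THE FROZEN END.**
There is an absolute `A` (witness `33`) such that for every `U > 0`, `δ ∈ (0,½)` and side `L ≥ 1` there is
a threshold `G = G(L,U)` (witness `max(1, 91 L⁴ √(U+18))`) beyond which every ground state `ψ` of the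
`N_L`-block of `H_g(L,U)` has `⟨ψ,(P†P)_B ψ⟩.re ≤ A·L²·(ψ†ψ).re`. Proof plan (card §Stubs): (i) electric
vacuum `ker Σ_b E_b = (fermions) ⊗ const`, `Σ_b E_b ≥ 1 − Π₀`; (ii) ground-state concentration
`g²‖(1−Π₀)ψ‖² ≤ (16L² + U·N_L + 2L²/g²)‖ψ‖²` (trial configuration ⊗ const has zero hopping expectation since
`Σ_u ρ(u) = 0`; U-, electric, magnetic terms PSD; `‖hop+hop†‖ ≤ 16L²`); (iii) flux orthogonality
`‖PΠ₀ψ‖² = Σ_b‖P_bΠ₀ψ‖² ≤ 32L²‖ψ‖²`; (iv) `‖Pψ‖ ≤ ‖PΠ₀ψ‖ + ‖P‖‖(1−Π₀)ψ‖`, `‖P‖ ≤ 8L²`. Statement-identical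
(modulo naming the matrix) to `Negation.PairCeiling` of `Cruxes/SgAnchorOrder/NegationSkeleton.lean` — ONE
proof serves both files. [refuter-rreview-0816T18-1-0 EVIDENCE v3 §3; doi:10.1103/physrevd.11.395;
doi:10.1103/physrevd.12.3978] -/
theorem stub_pairCeiling :
    ∃ A : ℝ, ∀ U : ℝ, 0 < U → ∀ δ ∈ Set.Ioo (0 : ℝ) (1 / 2), ∀ (L : ℕ) [NeZero L], ∃ G : ℝ,
      ∀ g : ℝ, G ≤ g → CeilingAt A U δ g L := by
  sorry

/-- **STUB 2 `stub_groundStateExists` — A NORMALISED GROUND STATE OF THE BLOCK EXISTS** for all `U, g : ℝ`,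
`δ ∈ (0,½)`, `L ≥ 1`: the inlined `H` is Hermitian, a principal block of a Hermitian matrix is Hermitian,
the index subtype `{ik // ik.1.card = N_L}` is non-empty (`N_L ≤ L² < 2L²` orbitals; any link
configuration), and the bottom vector of `Matrix.IsHermitian.eigenvectorBasis` is a unit eigenvector whose
eigenvalue minimises the Rayleigh quotient. Statement-identical (modulo naming) to
`Negation.GroundStateExists`. [Mathlib `Matrix.IsHermitian.eigenvalues`; GaugedHubbardTorus.lean
`GaugedHubbard.isHermitian_kronecker`; folklore] -/
theorem stub_groundStateExists :
    ∀ (U δ g : ℝ) (L : ℕ) [NeZero L], δ ∈ Set.Ioo (0 : ℝ) (1 / 2) → HasNormalisedGroundState U δ g L := by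
  sorry

/-! ### §4 Composition (everything below is sorry-free) -/

/-- Bookkeeping: the anchor crux IS "`OrderAt` on a half-line `[g₀,∞)` at some `(U,δ)` with one constant".
[bookkeeping] -/
theorem sgAnchorOrder_iff :
    SgAnchorOrder ↔ ∃ U : ℝ, 0 < U ∧ ∃ δ ∈ Set.Ioo (0 : ℝ) (1 / 2), ∃ g₀ : ℝ, 0 < g₀ ∧ ∃ c : ℝ,
      0 < c ∧ ∃ L₀ : ℕ, ∀ g : ℝ, g₀ ≤ g → OrderAt U δ g c L₀ :=
  Iff.rfl

/-- Bookkeeping: the route target IS "`CorridorOrderAt` at some `(U, δ)`". [bookkeeping] -/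
theorem sgCorridorOrder_iff :
    SgCorridorOrder ↔ ∃ U : ℝ, 0 < U ∧ ∃ δ ∈ Set.Ioo (0 : ℝ) (1 / 2), CorridorOrderAt U δ :=
  Iff.rfl

/-- **POINTWISE CORE — the anchor matrix is uninhabited on every half-line.** Given the two stubs, for any
`U > 0`, `δ ∈ (0,½)`, `c > 0`, any `g₀` and `L₀`, "order `≥ c L⁴‖ψ‖²` for all `g ≥ g₀` and all even
`L ≥ L₀`" is absurd: choose an even `L = 2(n + L₀ + 1)` with `A < c·L²` (Archimedes), the threshold
`G(L,U)` of the ceiling and `g := max g₀ G`; a normalised ground state `ψ` exists; the order hypothesis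
gives `c·L⁴ ≤ ⟨P†P⟩.re`, the ceiling `⟨P†P⟩.re ≤ A·L²` (the middle term is literally the same after
zeta-reduction of the shared let-block), and `A·L² < c·L²·L² = c·L⁴`. [this file; script adapted from
`NegationSkeleton.not_SgAnchorOrder_of_stubs` (planner-skel-stmt-HubbardSuperconductivity-16273-0)] -/
theorem orderOnHalfLine_false (hC : Sig.stub_pairCeiling) (hE : Sig.stub_groundStateExists)
    {U δ g₀ c : ℝ} {L₀ : ℕ} (hU : 0 < U) (hδ : δ ∈ Set.Ioo (0 : ℝ) (1 / 2)) (hc : 0 < c)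
    (hord : ∀ g : ℝ, g₀ ≤ g → OrderAt U δ g c L₀) : False := by
  obtain ⟨A, hA⟩ := hC
  -- choose the side: even, ≥ L₀, positive, with A < c·L²
  obtain ⟨n, hn⟩ := exists_nat_gt (A / c)
  obtain ⟨L, hL0, hLn, hLeven, hLpos⟩ :
      ∃ L : ℕ, L₀ ≤ L ∧ n < L ∧ Even L ∧ 0 < L :=
    ⟨2 * (n + L₀ + 1), by omega, by omega, ⟨n + L₀ + 1, by ring⟩, by omega⟩
  haveI : NeZero L := ⟨Nat.pos_iff_ne_zero.mp hLpos⟩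
  have hLreal : (1 : ℝ) ≤ (L : ℝ) := by exact_mod_cast hLpos
  have hL2pos : (0 : ℝ) < (L : ℝ) ^ 2 := by positivity
  have hAL : A < c * (L : ℝ) ^ 2 := by
    have h1 : (n : ℝ) < (L : ℝ) := by exact_mod_cast hLn
    have h2 : (L : ℝ) ≤ (L : ℝ) ^ 2 := by nlinarith
    have h3 : A / c < (L : ℝ) ^ 2 := lt_of_lt_of_le (hn.trans h1) h2
    have h4 : A < (L : ℝ) ^ 2 * c := (div_lt_iff₀ hc).mp h3
    linarith [mul_comm ((L : ℝ) ^ 2) c]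
  -- choose the coupling: beyond both thresholds
  obtain ⟨G, hG⟩ := hA U hU δ hδ L
  have hceil := hG (max g₀ G) (le_max_right g₀ G)
  have hcr := hord (max g₀ G) (le_max_left g₀ G) L hL0 hLeven
  have hex := hE U δ (max g₀ G) L hδ
  -- a normalised ground state, and the two inequalities through the shared let-block
  obtain ⟨ψ, hnorm, hGS⟩ := hex
  have h1 := hcr ψ hGS
  have h2 := hceil ψ hGS
  have hn1 : (star ψ ⬝ᵥ ψ).re = 1 := by rw [hnorm]; simp
  have h3 : c * (L : ℝ) ^ 4 * (star ψ ⬝ᵥ ψ).re ≤ A * (L : ℝ) ^ 2 * (star ψ ⬝ᵥ ψ).re :=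
    le_trans h1 h2
  rw [hn1, mul_one, mul_one] at h3
  clear h1 h2 hceil hcr hGS hnorm
  have h4 : A * (L : ℝ) ^ 2 < c * (L : ℝ) ^ 2 * (L : ℝ) ^ 2 := mul_lt_mul_of_pos_right hAL hL2pos
  have h5 : c * (L : ℝ) ^ 4 = c * (L : ℝ) ^ 2 * (L : ℝ) ^ 2 := by ring
  linarith

/-- **The hypothesis of the crux is refutable from the two stubs**: `¬ SgAnchorOrder` (the same statement as
`NegationSkeleton.not_SgAnchorOrder_of_stubs`, over this file's named stubs). Landing it as a theorem
(`--kind refutation --workitem stmt-HubbardSuperconductivity-16273`, class `substantive`) closes the anchor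
item and triggers the route's own kill criterion. -/
theorem not_SgAnchorOrder_of_stubs (hC : Sig.stub_pairCeiling) (hE : Sig.stub_groundStateExists) :
    ¬ SgAnchorOrder := by
  intro hA
  obtain ⟨U, hU, δ, hδ, g₀, hg₀, c, hc, L₀, hord⟩ := sgAnchorOrder_iff.1 hA
  exact orderOnHalfLine_false hC hE hU hδ hc hord

/-- **`SgCorridor` from the two stubs** (ex falso quodlibet: the implication's hypothesis is uninhabited).
Hypothesis heads `Sig.stub_*` carry the registered stub names; conclusion = the route decl BY NAME. -/
theorem SgCorridor_of :
    Sig.stub_pairCeiling → Sig.stub_groundStateExists → SgCorridor :=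
  fun hC hE => show SgAnchorOrder → SgCorridorOrder from
    fun hA => (not_SgAnchorOrder_of_stubs hC hE hA).elim

/-- **The skeleton in its final shape**: the crux BY NAME from the two registered stubs (depends on
`sorryAx` only through `stub_pairCeiling`, `stub_groundStateExists`). -/
theorem SgCorridor_proof : SgCorridor :=
  SgCorridor_of stub_pairCeiling stub_groundStateExists

/-! ### §5 The birth line is discharged by the same two stubs (its hypotheses are uninhabited) -/

/-- `HalfLineOrder U δ` is uninhabited for every `U > 0`, `δ ∈ (0,½)`: take the floor `g₁ = 1`. -/
theorem halfLineOrder_false (hC : Sig.stub_pairCeiling) (hE : Sig.stub_groundStateExists)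
    {U δ : ℝ} (hU : 0 < U) (hδ : δ ∈ Set.Ioo (0 : ℝ) (1 / 2)) : ¬ HalfLineOrder U δ := by
  intro h
  obtain ⟨c₁, hc₁, L₁, hord⟩ := h 1 one_pos
  exact orderOnHalfLine_false hC hE hU hδ hc₁ hord

/-- The STATEMENT of `Lines/birth.lean`'s `stub_halfLinePersistence` (over this file's verbatim copy of
birth's vocabulary) follows from the two stubs — vacuously: its order hypothesis is uninhabited. -/
theorem birth_stub_halfLinePersistence_of (hC : Sig.stub_pairCeiling) (hE : Sig.stub_groundStateExists) :
    ∀ (U δ g₀ c : ℝ) (L₀ : ℕ), 0 < U → δ ∈ Set.Ioo (0 : ℝ) (1 / 2) → 0 < g₀ → 0 < c →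
      (∀ g : ℝ, g₀ ≤ g → OrderAt U δ g c L₀) → HalfLineOrder U δ :=
  fun U δ g₀ c L₀ hU hδ _ hc hord => (orderOnHalfLine_false hC hE hU hδ hc hord).elim

/-- The STATEMENT of `Lines/birth.lean`'s `stub_zeroCouplingFloor` follows from the two stubs — vacuously:
`HalfLineOrder U δ` is uninhabited. -/
theorem birth_stub_zeroCouplingFloor_of (hC : Sig.stub_pairCeiling) (hE : Sig.stub_groundStateExists) :
    ∀ (U δ : ℝ), 0 < U → δ ∈ Set.Ioo (0 : ℝ) (1 / 2) → HalfLineOrder U δ → CorridorOrderAt U δ :=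
  fun U δ hU hδ h => (halfLineOrder_false hC hE hU hδ h).elim


/-! ### §6 Kernel-checked algebraic inputs for the two stubs (no `sorry`; `rQ` is character-identical to
the let-bound `r` of the route items, `fQ u σ τ` to the link factor `if σ = 0 then r (k b) 1 τ else
-r (k b) 0 τ` of the inlined pair field `P` at `u = k b`) -/

/-- The route's inlined spin-½ representation `ρ` of `Q8` coded on `Fin 2 × ZMod 4` (verbatim the
let-bound `r`). -/
def rQ : Fin 2 × ZMod 4 → Fin 2 → Fin 2 → ℂ := fun u σ τ =>
  if u.1 = 0 then (if σ = τ then (if σ = 0 then Complex.I else -Complex.I) ^ u.2.val else 0)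
  else if σ = τ then 0 else if σ = 0 then -(-Complex.I) ^ u.2.val else Complex.I ^ u.2.val

/-- The pair link factor `(ερ(u))_{στ}` of the inlined `P`. -/
def fQ : Fin 2 × ZMod 4 → Fin 2 → Fin 2 → ℂ := fun u σ τ =>
  if σ = 0 then rQ u 1 τ else -rQ u 0 τ

/-- Summation over `ZMod 4` made explicit. [bookkeeping] -/
theorem sum_zmod_four (F : ZMod 4 → ℂ) : ∑ i : ZMod 4, F i = F 0 + F 1 + F 2 + F 3 := by
  show ∑ i : Fin 4, F i = _
  simp [Fin.sum_univ_four]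
  rfl

theorem zmod_four_val_one : (1 : ZMod 4).val = 1 := rfl
theorem zmod_four_val_two : (2 : ZMod 4).val = 2 := rfl
theorem zmod_four_val_three : (3 : ZMod 4).val = 3 := rfl

/-- **ELITZUR INPUT** (used by stub 1, steps (ii) and (iii)): every matrix entry of `ρ` has zero
`Q8`-average, `Σ_u ρ(u)_{στ} = 0` — the hopping has zero expectation in the electric vacuum and single
hops create flux. [doi:10.1103/physrevd.12.3978; this file] -/
theorem sum_rQ (σ τ : Fin 2) : ∑ u : Fin 2 × ZMod 4, rQ u σ τ = 0 := by
  rw [Fintype.sum_prod_type, Fin.sum_univ_two, sum_zmod_four, sum_zmod_four]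
  fin_cases σ <;> fin_cases τ <;> simp [rQ, zmod_four_val_one, zmod_four_val_two, zmod_four_val_three, pow_succ]

/-- **FLUX CREATION BY THE PAIR FIELD** (stub 1, step (iii)): every pair link factor has zero `Q8`-average,
so `P_b` maps the electric vacuum into flux on `b`. [this file] -/
theorem sum_fQ (σ τ : Fin 2) : ∑ u : Fin 2 × ZMod 4, fQ u σ τ = 0 := by
  fin_cases σ <;> simp [fQ, Finset.sum_neg_distrib, sum_rQ]

/-- **SCHUR ORTHOGONALITY OF THE PAIR LINK FACTORS** (stub 1, step (iii), the diagonal `b = b'` terms):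
`Σ_u conj(f(u)_{στ}) f(u)_{σ'τ'} = 4 δ_{σσ'} δ_{ττ'}`, i.e. `‖P_b Π₀ψ‖² = ½ Σ_{στ} ‖c_{xσ}c_{yτ} ψ_f‖²`.
[Schur orthogonality for the 2-dimensional irrep of `Q8`; this file] -/
theorem schur_fQ (σ τ σ' τ' : Fin 2) :
    ∑ u : Fin 2 × ZMod 4, (starRingEnd ℂ) (fQ u σ τ) * fQ u σ' τ' =
      if σ = σ' ∧ τ = τ' then 4 else 0 := by
  rw [Fintype.sum_prod_type, Fin.sum_univ_two, sum_zmod_four, sum_zmod_four]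
  fin_cases σ <;> fin_cases τ <;> fin_cases σ' <;> fin_cases τ' <;>
    simp [fQ, rQ, zmod_four_val_one, zmod_four_val_two, zmod_four_val_three, pow_succ, Complex.ext_iff] <;>
    norm_num

/-- **SCHUR ORTHOGONALITY OF `ρ`** (`Σ_u conj(ρ(u)_{στ}) ρ(u)_{σ'τ'} = 4 δ_{σσ'} δ_{ττ'}`): second-order
processes through one excited link are spin-blind (no exchange at order `t²/g²` — the frozen end is a
classical lattice gas of immobile charges, cf. the card's §Why-substantive). [this file] -/
theorem schur_rQ (σ τ σ' τ' : Fin 2) :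
    ∑ u : Fin 2 × ZMod 4, (starRingEnd ℂ) (rQ u σ τ) * rQ u σ' τ' =
      if σ = σ' ∧ τ = τ' then 4 else 0 := by
  rw [Fintype.sum_prod_type, Fin.sum_univ_two, sum_zmod_four, sum_zmod_four]
  fin_cases σ <;> fin_cases τ <;> fin_cases σ' <;> fin_cases τ' <;>
    simp [rQ, zmod_four_val_one, zmod_four_val_two, zmod_four_val_three, pow_succ, Complex.ext_iff] <;>
    norm_num

/-- **TRACES ARE SELF-CONJUGATE** (stub 2: the inlined magnetic term, a complex diagonal matrix with entries
`Σ_x (1 − ½ tr ρ(hol))`, is Hermitian): `conj (tr ρ(u)) = tr ρ(u)` (`tr ρ(u) ∈ {2, 0, −2}`). [this file] -/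
theorem trace_rQ_conj (u : Fin 2 × ZMod 4) :
    (starRingEnd ℂ) (rQ u 0 0 + rQ u 1 1) = rQ u 0 0 + rQ u 1 1 := by
  obtain ⟨a, i⟩ := u
  fin_cases a <;> simp [rQ, map_neg, Complex.conj_I, add_comm]

end Summit.HubbardSuperconductivity.HubbardSuperconductivity.Cruxes.SgCorridor.AnchorVacuity

end
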